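import Literature.Probability.Process.BrownianPair
import Literature.Probability.Process.BrownianQuadraticSums
import Literature.Probability.Process.DoobMaximalIneq
import Literature.Probability.Process.DoobL2Inequality
import HarnessLib

/-!
# The running maximum of Brownian motion on a short interval: an `O(h²)` tail bound, and the pair

Trunk T-PROBABILITY (Literature/Probability/Process). Elementary estimates for the canonical
Brownian motion `brownian` (pre-Wiener measure) and for the pair of independent Brownian motions
on `WienerPair` (`BrownianPair.lean`), in the form consumed by one-step (generator) estimates for
SDEs with additive noise (provefact unit `CuneoEckmannHairerReyBellet2018_pinnedChain`, Dynkin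
identity of the Langevin chain):

* moments at a fixed time: `E B_h = 0`, `E B_h² = h`, `E B_h⁴ = 3h²`, `E[(B_h² - h)²] = 2h²`,
  integrability of `|B_h|ⁿ`; the same on the pair space for each coordinate
  (`integral_brownian_fst_sq`, …) and `E[B_s(ω₁)B_t(ω₂)] = 0`; transfer lemmas
  `integral_wienerPair_fst/snd`, `integrable_wienerPair_fst/snd`.
* `measure_exists_le_abs_brownian_le` — **`P(∃ s ≤ h, a ≤ |B_s|) ≤ 2h²/(a² - h)²`** for `a ≥ 0`,
  `a² > h`: Doob's maximal inequality (`doob_sq_maximal_ineq_of_continuous`, `DoobMaximalIneq.lean`)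
  for the martingale `B_t² - t` (`martingale_brownian_sq_sub_holds`). This is `O(h²)` as `h → 0`
  for fixed `a`, which is what makes the complement of the good event negligible at order `o(h)`.
* `goodEvent a h` — the event `{sup_{s≤h}|B¹_s| ≤ a, sup_{s≤h}|B²_s| ≤ a}` of the pair, defined
  through the dyadic times (measurable, `measurableSet_goodEvent`), equal on continuous paths to the
  event for all `s ≤ h` (`abs_brownian_le_of_mem_goodEvent`, also in real time through `toNNReal`),
  with `P(goodEventᶜ) ≤ 2 · 2h²/(a² - h)²` (`measure_compl_goodEvent_le`).

## References

* D. Revuz, M. Yor, *Continuous Martingales and Brownian Motion* (3rd ed., 1999), Ch. II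
  Thm (1.7) (Doob's maximal inequality), Ch. I (moments of Gaussian increments). [folklore]
-/

noncomputable section

open MeasureTheory ProbabilityTheory Filter Topology Set
open scoped NNReal ENNReal

namespace Literature.Probability.Process

/-! ### Moments of `B_h` -/

/-- `B_h = B_h - B_0`. [folklore] -/
theorem brownian_eq_sub_zero (h : ℝ≥0) : brownian h = brownian h - brownian 0 := by
  rw [brownian_zero, sub_zero]

/-- `E[B_h²] = h`. [folklore] -/
theorem integral_brownian_sq (h : ℝ≥0) : ∫ ω, brownian h ω ^ 2 ∂preWienerMeasure = h := by
  have := RandomPlanarGeometry.integral_brownian_sub_sq (s := 0) (t := h) bot_le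
  rw [brownian_zero, sub_zero, NNReal.coe_zero, sub_zero] at this
  exact this

/-- `E[B_h⁴] = 3h²`. [folklore] -/
theorem integral_brownian_pow_four (h : ℝ≥0) : ∫ ω, brownian h ω ^ 4 ∂preWienerMeasure = 3 * (h : ℝ) ^ 2 := by
  have := integral_brownian_sub_pow_four 0 h
  rw [brownian_zero, sub_zero, NNReal.coe_zero, sub_zero] at this
  exact this

/-- `B_h` has moments of all finite orders. [folklore] -/
theorem memLp_brownian (h : ℝ≥0) {p : ℝ≥0∞} (hp : p ≠ ∞) : MemLp (brownian h) p preWienerMeasure := by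
  have := memLp_brownian_sub 0 h hp
  rwa [brownian_zero, sub_zero] at this

/-- `|B_h|^n` is integrable for every `n`. [folklore] -/
theorem integrable_abs_brownian_pow (h : ℝ≥0) (n : ℕ) :
    Integrable (fun ω => |brownian h ω| ^ n) preWienerMeasure := by
  rcases Nat.eq_zero_or_pos n with hn | hn
  · subst hn
    haveI := RandomPlanarGeometry.isProbabilityMeasure_preWienerMeasure'
    simp
  · have h1 := (memLp_brownian h (p := (n : ℝ≥0∞)) (by simp)).integrable_norm_rpow
      (by exact_mod_cast hn.ne') (by simp)
    refine h1.congr (Eventually.of_forall fun ω => ?_)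
    simp [Real.norm_eq_abs, Real.rpow_natCast]

/-- `B_h^n` is integrable for every `n`. [folklore] -/
theorem integrable_brownian_pow (h : ℝ≥0) (n : ℕ) :
    Integrable (fun ω => brownian h ω ^ n) preWienerMeasure := by
  refine (integrable_abs_brownian_pow h n).mono' ((measurable_brownian h).pow_const n).aestronglyMeasurable
    (Eventually.of_forall fun ω => ?_)
  rw [Real.norm_eq_abs, abs_pow]

/-- `E[(B_h² - h)²] = 2h²`. [folklore] -/
theorem integral_brownian_sq_sub_sq (h : ℝ≥0) :
    ∫ ω, (brownian h ω ^ 2 - h) ^ 2 ∂preWienerMeasure = 2 * (h : ℝ) ^ 2 := by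
  haveI := RandomPlanarGeometry.isProbabilityMeasure_preWienerMeasure'
  have h4 := integrable_brownian_pow h 4
  have h2 := integrable_brownian_pow h 2
  have hexp : (fun ω => (brownian h ω ^ 2 - h) ^ 2) =
      fun ω => brownian h ω ^ 4 - 2 * h * brownian h ω ^ 2 + (h : ℝ) ^ 2 := by
    funext ω; ring
  have h42 : Integrable (fun ω => brownian h ω ^ 4 - 2 * h * brownian h ω ^ 2) preWienerMeasure :=
    h4.sub (h2.const_mul _)
  rw [hexp, integral_add h42 (integrable_const _), integral_sub h4 (h2.const_mul _),
    integral_const_mul, integral_brownian_pow_four, integral_brownian_sq, integral_const]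
  simp only [probReal_univ, smul_eq_mul, one_mul]
  ring

/-! ### The running maximum on `[0, h]` -/

/-- **Tail of the running maximum of Brownian motion on a short interval**:
`P(∃ s ≤ h, a ≤ |B_s|) ≤ 2h²/(a² - h)²` for `a ≥ 0`, `a² > h` — Doob's maximal inequality for the
martingale `B_t² - t` (`{a ≤ |B_s|} ⊆ {a² - h ≤ |B_s² - s|}` for `s ≤ h`, and
`E[(B_h² - h)²] = 2h²`). An `O(h²)` bound, as needed for `o(h)` one-step estimates.
Revuz–Yor, *Continuous Martingales and Brownian Motion* (1999), Ch. II (1.7). [folklore] -/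
theorem measure_exists_le_abs_brownian_le (h : ℝ≥0) {a : ℝ} (ha0 : 0 ≤ a) (ha : (h : ℝ) < a ^ 2) :
    preWienerMeasure {ω | ∃ s ≤ h, a ≤ |brownian s ω|} ≤
      ENNReal.ofReal (2 * (h : ℝ) ^ 2 / (a ^ 2 - h) ^ 2) := by
  haveI := RandomPlanarGeometry.isProbabilityMeasure_preWienerMeasure'
  set M : ℝ≥0 → (ℝ≥0 → ℝ) → ℝ := fun t ω => brownian t ω ^ 2 - (t : ℝ) with hM
  have hmart : Martingale M RandomPlanarGeometry.brownianFiltration preWienerMeasure :=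
    RandomPlanarGeometry.martingale_brownian_sq_sub_holds
  have hL2 : ∀ s, MemLp (M s) 2 preWienerMeasure := fun s => by
    have h1 := memLp_two_brownian_sub_sq 0 s
    simp only [brownian_zero, sub_zero] at h1
    exact h1.sub (memLp_const _)
  have hcont : ∀ᵐ ω ∂preWienerMeasure, Continuous fun t => M t ω :=
    Eventually.of_forall fun ω => ((continuous_brownian ω).pow 2).sub NNReal.continuous_coe
  have hε : 0 < a ^ 2 - h := sub_pos.2 ha
  have hD := doob_sq_maximal_ineq_of_continuous hmart hL2 hcont hε h
  have hsub : {ω | ∃ s ≤ h, a ≤ |brownian s ω|} ⊆ {ω | ∃ s ≤ h, a ^ 2 - h ≤ |M s ω|} := by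
    rintro ω ⟨s, hs, hsa⟩
    refine ⟨s, hs, ?_⟩
    have h1 : a ^ 2 ≤ brownian s ω ^ 2 := by
      nlinarith [abs_nonneg (brownian s ω), sq_abs (brownian s ω)]
    have h2 : (s : ℝ) ≤ h := by exact_mod_cast hs
    simp only [hM]
    exact le_trans (by linarith) (le_abs_self _)
  refine (measure_mono hsub).trans (hD.trans (le_of_eq ?_))
  rw [integral_brownian_sq_sub_sq]


/-! ### The pair of Brownian motions: moments at a fixed time -/

section Pair

/-- First-coordinate functionals: `∫ F(ω₁) d(wienerPair) = ∫ F d(preWiener)`. [folklore] -/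
theorem integral_wienerPair_fst (F : (ℝ≥0 → ℝ) → ℝ) :
    ∫ ω, F ω.1 ∂wienerPair = ∫ ω₁, F ω₁ ∂preWienerMeasure := by
  haveI := RandomPlanarGeometry.isProbabilityMeasure_preWienerMeasure'
  have h := integral_prod_mul (μ := preWienerMeasure) (ν := preWienerMeasure) F (fun _ => (1 : ℝ))
  simp only [mul_one, integral_const, probReal_univ, smul_eq_mul] at h
  rw [wienerPair, h]

/-- Second-coordinate functionals: `∫ F(ω₂) d(wienerPair) = ∫ F d(preWiener)`. [folklore] -/
theorem integral_wienerPair_snd (F : (ℝ≥0 → ℝ) → ℝ) :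
    ∫ ω, F ω.2 ∂wienerPair = ∫ ω₂, F ω₂ ∂preWienerMeasure := by
  haveI := RandomPlanarGeometry.isProbabilityMeasure_preWienerMeasure'
  have h := integral_prod_mul (μ := preWienerMeasure) (ν := preWienerMeasure) (fun _ => (1 : ℝ)) F
  simp only [one_mul, integral_const, probReal_univ, smul_eq_mul] at h
  rw [wienerPair, h]

/-- Integrability of first-coordinate functionals. [folklore] -/
theorem integrable_wienerPair_fst {F : (ℝ≥0 → ℝ) → ℝ} (hF : Integrable F preWienerMeasure) :
    Integrable (fun ω : WienerPair => F ω.1) wienerPair := by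
  haveI := RandomPlanarGeometry.isProbabilityMeasure_preWienerMeasure'
  exact ((measurePreserving_fst (μ := preWienerMeasure) (ν := preWienerMeasure)).integrable_comp
    hF.aestronglyMeasurable).2 hF

/-- Integrability of second-coordinate functionals. [folklore] -/
theorem integrable_wienerPair_snd {F : (ℝ≥0 → ℝ) → ℝ} (hF : Integrable F preWienerMeasure) :
    Integrable (fun ω : WienerPair => F ω.2) wienerPair := by
  haveI := RandomPlanarGeometry.isProbabilityMeasure_preWienerMeasure'
  exact ((measurePreserving_snd (μ := preWienerMeasure) (ν := preWienerMeasure)).integrable_comp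
    hF.aestronglyMeasurable).2 hF

/-- The product of independent centred coordinates integrates to zero:
`E[B_s(ω₁) B_t(ω₂)] = 0`. [folklore] -/
theorem integral_brownian_fst_mul_brownian_snd (s t : ℝ≥0) :
    ∫ ω : WienerPair, brownian s ω.1 * brownian t ω.2 ∂wienerPair = 0 := by
  haveI := RandomPlanarGeometry.isProbabilityMeasure_preWienerMeasure'
  have h := integral_prod_mul (μ := preWienerMeasure) (ν := preWienerMeasure) (brownian s) (brownian t)
  rw [wienerPair, h, RandomPlanarGeometry.isPreBrownianReal_brownian.integral_eval, zero_mul]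

/-- `E[B_h(ω_b)] = 0`, `E[B_h(ω_b)²] = h`, `E[B_h(ω_b)⁴] = 3h²` for both coordinates of the pair,
and integrability of `|B_h(ω_b)|ⁿ`. [folklore] -/
theorem integral_brownian_fst (h : ℝ≥0) : ∫ ω : WienerPair, brownian h ω.1 ∂wienerPair = 0 := by
  rw [integral_wienerPair_fst (brownian h), RandomPlanarGeometry.isPreBrownianReal_brownian.integral_eval]

/-- `E[B_h(ω₂)] = 0`. [folklore] -/
theorem integral_brownian_snd (h : ℝ≥0) : ∫ ω : WienerPair, brownian h ω.2 ∂wienerPair = 0 := by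
  rw [integral_wienerPair_snd (brownian h), RandomPlanarGeometry.isPreBrownianReal_brownian.integral_eval]

/-- `E[B_h(ω₁)²] = h`. [folklore] -/
theorem integral_brownian_fst_sq (h : ℝ≥0) : ∫ ω : WienerPair, brownian h ω.1 ^ 2 ∂wienerPair = h := by
  rw [integral_wienerPair_fst (fun ω₁ => brownian h ω₁ ^ 2), integral_brownian_sq]

/-- `E[B_h(ω₂)²] = h`. [folklore] -/
theorem integral_brownian_snd_sq (h : ℝ≥0) : ∫ ω : WienerPair, brownian h ω.2 ^ 2 ∂wienerPair = h := by
  rw [integral_wienerPair_snd (fun ω₂ => brownian h ω₂ ^ 2), integral_brownian_sq]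

/-- `E[B_h(ω₁)⁴] = 3h²`. [folklore] -/
theorem integral_brownian_fst_pow_four (h : ℝ≥0) :
    ∫ ω : WienerPair, brownian h ω.1 ^ 4 ∂wienerPair = 3 * (h : ℝ) ^ 2 := by
  rw [integral_wienerPair_fst (fun ω₁ => brownian h ω₁ ^ 4), integral_brownian_pow_four]

/-- `E[B_h(ω₂)⁴] = 3h²`. [folklore] -/
theorem integral_brownian_snd_pow_four (h : ℝ≥0) :
    ∫ ω : WienerPair, brownian h ω.2 ^ 4 ∂wienerPair = 3 * (h : ℝ) ^ 2 := by
  rw [integral_wienerPair_snd (fun ω₂ => brownian h ω₂ ^ 4), integral_brownian_pow_four]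

/-- `|B_h(ω₁)|ⁿ` is integrable on the pair space. [folklore] -/
theorem integrable_abs_brownian_fst_pow (h : ℝ≥0) (n : ℕ) :
    Integrable (fun ω : WienerPair => |brownian h ω.1| ^ n) wienerPair :=
  integrable_wienerPair_fst (F := fun ω₁ => |brownian h ω₁| ^ n) (integrable_abs_brownian_pow h n)

/-- `|B_h(ω₂)|ⁿ` is integrable on the pair space. [folklore] -/
theorem integrable_abs_brownian_snd_pow (h : ℝ≥0) (n : ℕ) :
    Integrable (fun ω : WienerPair => |brownian h ω.2| ^ n) wienerPair :=
  integrable_wienerPair_snd (F := fun ω₂ => |brownian h ω₂| ^ n) (integrable_abs_brownian_pow h n)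

/-- `B_h(ω₁)ⁿ` is integrable on the pair space. [folklore] -/
theorem integrable_brownian_fst_pow (h : ℝ≥0) (n : ℕ) :
    Integrable (fun ω : WienerPair => brownian h ω.1 ^ n) wienerPair :=
  integrable_wienerPair_fst (F := fun ω₁ => brownian h ω₁ ^ n) (integrable_brownian_pow h n)

/-- `B_h(ω₂)ⁿ` is integrable on the pair space. [folklore] -/
theorem integrable_brownian_snd_pow (h : ℝ≥0) (n : ℕ) :
    Integrable (fun ω : WienerPair => brownian h ω.2 ^ n) wienerPair :=
  integrable_wienerPair_snd (F := fun ω₂ => brownian h ω₂ ^ n) (integrable_brownian_pow h n)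

end Pair

/-! ### The pair of running maxima on `[0, h]`: the good event -/

section Good

/-- The **good event** `{sup_{s ≤ h} |B¹_s| ≤ a, sup_{s ≤ h} |B²_s| ≤ a}` of the pair of
Brownian motions, written through the countable family of dyadic times `m/2ⁿ ≤ h` (on the
continuous paths of `brownian` this is the same event, `abs_brownian_le_of_mem_goodEvent`).
[folklore] -/
def goodEvent (a : ℝ) (h : ℝ≥0) : Set WienerPair :=
  {ω | ∀ n m : ℕ, ((m : ℝ≥0) / 2 ^ n ≤ h) →
    |brownian ((m : ℝ≥0) / 2 ^ n) ω.1| ≤ a ∧ |brownian ((m : ℝ≥0) / 2 ^ n) ω.2| ≤ a}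

/-- The good event is measurable (a countable intersection). [folklore] -/
theorem measurableSet_goodEvent (a : ℝ) (h : ℝ≥0) : MeasurableSet (goodEvent a h) := by
  have h1 : goodEvent a h = ⋂ n : ℕ, ⋂ m : ℕ, {ω : WienerPair | ((m : ℝ≥0) / 2 ^ n ≤ h) →
      |brownian ((m : ℝ≥0) / 2 ^ n) ω.1| ≤ a ∧ |brownian ((m : ℝ≥0) / 2 ^ n) ω.2| ≤ a} := by
    ext ω; simp [goodEvent]
  rw [h1]
  refine MeasurableSet.iInter fun n => MeasurableSet.iInter fun m => ?_
  by_cases hmn : (m : ℝ≥0) / 2 ^ n ≤ h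
  · simp only [hmn, forall_const]
    exact (measurableSet_le ((measurable_brownian _).comp measurable_fst).abs measurable_const).inter
      (measurableSet_le ((measurable_brownian _).comp measurable_snd).abs measurable_const)
  · simp [hmn]

/-- **On the good event both running maxima are at most `a`** (every `s ≤ h` is the limit of the
dyadic times `⌊s2ⁿ⌋/2ⁿ ≤ s`, and the paths are continuous). [folklore] -/
theorem abs_brownian_le_of_mem_goodEvent {a : ℝ} {h : ℝ≥0} {ω : WienerPair} (hω : ω ∈ goodEvent a h)
    {s : ℝ≥0} (hs : s ≤ h) :
    |brownian s ω.1| ≤ a ∧ |brownian s ω.2| ≤ a := by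
  set r : ℕ → ℝ≥0 := fun n => ((⌊(s : ℝ) * 2 ^ n⌋₊ : ℕ) : ℝ≥0) / 2 ^ n with hr
  have hrs : ∀ n, r n ≤ s := fun n => by
    rw [hr]
    show ((⌊(s : ℝ) * 2 ^ n⌋₊ : ℕ) : ℝ≥0) / 2 ^ n ≤ s
    rw [div_le_iff₀ (pow_pos two_pos n), ← NNReal.coe_le_coe]
    push_cast
    exact Nat.floor_le (by positivity)
  have hten : Tendsto r atTop (𝓝 s) := tendsto_nat_floor_div_two_pow s
  have hgood : ∀ n, |brownian (r n) ω.1| ≤ a ∧ |brownian (r n) ω.2| ≤ a := fun n => by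
    have := hω n (⌊(s : ℝ) * 2 ^ n⌋₊) ((hrs n).trans hs)
    exact this
  constructor
  · have hc : Tendsto (fun n => |brownian (r n) ω.1|) atTop (𝓝 |brownian s ω.1|) :=
      ((continuous_abs.comp (continuous_brownian ω.1)).tendsto s).comp hten
    exact le_of_tendsto' hc fun n => (hgood n).1
  · have hc : Tendsto (fun n => |brownian (r n) ω.2|) atTop (𝓝 |brownian s ω.2|) :=
      ((continuous_abs.comp (continuous_brownian ω.2)).tendsto s).comp hten
    exact le_of_tendsto' hc fun n => (hgood n).2

/-- On the good event, `|B¹_s|, |B²_s| ≤ a` for every REAL time `s ≤ h` read through `toNNReal`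
(the form used by noise paths indexed by real time). [folklore] -/
theorem abs_brownian_toNNReal_le_of_mem_goodEvent {a : ℝ} {h : ℝ≥0} {ω : WienerPair}
    (hω : ω ∈ goodEvent a h) {s : ℝ} (hs : s ≤ h) :
    |brownian s.toNNReal ω.1| ≤ a ∧ |brownian s.toNNReal ω.2| ≤ a :=
  abs_brownian_le_of_mem_goodEvent hω (by
    rw [← NNReal.coe_le_coe, Real.coe_toNNReal']
    exact max_le hs h.coe_nonneg)

/-- **The bad event is `O(h²)`**: `P((goodEvent a h)ᶜ) ≤ 2 · 2h²/(a² - h)²` for `a ≥ 0`,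
`a² > h`. [folklore] -/
theorem measure_compl_goodEvent_le {a : ℝ} (ha0 : 0 ≤ a) (h : ℝ≥0) (ha : (h : ℝ) < a ^ 2) :
    wienerPair (goodEvent a h)ᶜ ≤ 2 * ENNReal.ofReal (2 * (h : ℝ) ^ 2 / (a ^ 2 - h) ^ 2) := by
  haveI := RandomPlanarGeometry.isProbabilityMeasure_preWienerMeasure'
  set A : Set (ℝ≥0 → ℝ) := {ω₁ | ∃ s ≤ h, a ≤ |brownian s ω₁|} with hA
  have hsub : (goodEvent a h)ᶜ ⊆ (A ×ˢ univ) ∪ (univ ×ˢ A) := by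
    intro ω hω
    simp only [goodEvent, mem_compl_iff, mem_setOf_eq, not_forall, not_and_or, not_le] at hω
    obtain ⟨n, m, hmn, hω⟩ := hω
    rcases hω with h1 | h2
    · exact Or.inl ⟨⟨_, hmn, h1.le⟩, mem_univ _⟩
    · exact Or.inr ⟨mem_univ _, ⟨_, hmn, h2.le⟩⟩
  have hb := measure_exists_le_abs_brownian_le h ha0 ha
  calc wienerPair (goodEvent a h)ᶜ ≤ wienerPair ((A ×ˢ univ) ∪ (univ ×ˢ A)) := measure_mono hsub
    _ ≤ wienerPair (A ×ˢ univ) + wienerPair (univ ×ˢ A) := measure_union_le _ _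
    _ = preWienerMeasure A + preWienerMeasure A := by
        rw [wienerPair, Measure.prod_prod, Measure.prod_prod, measure_univ, mul_one, one_mul]
    _ ≤ ENNReal.ofReal (2 * (h : ℝ) ^ 2 / (a ^ 2 - h) ^ 2) +
          ENNReal.ofReal (2 * (h : ℝ) ^ 2 / (a ^ 2 - h) ^ 2) := add_le_add hb hb
    _ = 2 * ENNReal.ofReal (2 * (h : ℝ) ^ 2 / (a ^ 2 - h) ^ 2) := (two_mul _).symm

end Good

end Literature.Probability.Process
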